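import Summits.QuantumFields.GaugeBoot.Rows.GLYZc2D4LTab
import HarnessLib

/-!
# Gauge-boot: kernel check of the raw `link1` class table of the glyz-c2-4D problems, rows 180–224 (part 8/10)

Cell `pub-gaugeboot` (HOME `run/shared/lean/pub/pub-gaugeboot/`), seat lean1 (torus layer for rows C76–C87 = the certified
glyz-c2-4D windows: label set, raw blocks, class/witness tables, the reduction identity, per-β bindings).

HONEST FRAMING (page 1 of every file of this cell): certified bounds on lattice expectations at STATED coupling,
gauge group, dimension and torus size; NOT a mass gap, NOT a continuum limit, NOT a string tension, NOT large `N`.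
The venture is explicitly NOT Yang–Mills-summit-bearing (barriers `FixedCouplingUltralocality`,
`PerturbativeInvisibility`).

`lcanon_rows_<lo>_<hi> : ∀ i, lo ≤ i < hi → ∀ j ≥ i, GLYZc2D4.LCanonOK i j`, each range one closed computation (`decide +kernel`);
assembled in `GLYZc2D4Canon`.
-/

noncomputable section

open Literature.MathematicalPhysics.QuantumFieldTheory

namespace Summit.QuantumFields.GaugeBoot

namespace GLYZc2D4

set_option maxHeartbeats 0 in
/-- Rows `180 ≤ i < 188` of the `link1` class table of the glyz-c2-4D problems canonicalise (1220 entries; kernel). -/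
theorem lcanon_rows_180_188 : ∀ i : Fin 336, 180 ≤ i.val → i.val < 188 → ∀ j : Fin 336, i.val ≤ j.val → GLYZc2D4.LCanonOK i j := by
  decide +kernel

set_option maxHeartbeats 0 in
/-- Rows `188 ≤ i < 196` of the `link1` class table of the glyz-c2-4D problems canonicalise (1156 entries; kernel). -/
theorem lcanon_rows_188_196 : ∀ i : Fin 336, 188 ≤ i.val → i.val < 196 → ∀ j : Fin 336, i.val ≤ j.val → GLYZc2D4.LCanonOK i j := by
  decide +kernel

set_option maxHeartbeats 0 in
/-- Rows `196 ≤ i < 205` of the `link1` class table of the glyz-c2-4D problems canonicalise (1224 entries; kernel). -/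
theorem lcanon_rows_196_205 : ∀ i : Fin 336, 196 ≤ i.val → i.val < 205 → ∀ j : Fin 336, i.val ≤ j.val → GLYZc2D4.LCanonOK i j := by
  decide +kernel

set_option maxHeartbeats 0 in
/-- Rows `205 ≤ i < 215` of the `link1` class table of the glyz-c2-4D problems canonicalise (1265 entries; kernel). -/
theorem lcanon_rows_205_215 : ∀ i : Fin 336, 205 ≤ i.val → i.val < 215 → ∀ j : Fin 336, i.val ≤ j.val → GLYZc2D4.LCanonOK i j := by
  decide +kernel

set_option maxHeartbeats 0 in
/-- Rows `215 ≤ i < 225` of the `link1` class table of the glyz-c2-4D problems canonicalise (1165 entries; kernel). -/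
theorem lcanon_rows_215_225 : ∀ i : Fin 336, 215 ≤ i.val → i.val < 225 → ∀ j : Fin 336, i.val ≤ j.val → GLYZc2D4.LCanonOK i j := by
  decide +kernel

end GLYZc2D4

end Summit.QuantumFields.GaugeBoot

end
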